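import Mathlib
import Summits.KontsevichZagierPeriods.KontsevichZagierPeriods.Theorems.SoloInformedCubeWord
import Literature.NumberTheory.Transcendental.MZVWordShuffle
import Literature.NumberTheory.Transcendental.MultipleZetaHoffmanDualProofs
import HarnessLib
import HarnessLib.Audit

/-!
# Hoffman words: the binary word of an index with one letter `1` inserted

Combinatorics for THEOREM L (Hoffman's relation in the formal period ring `𝒫`): the word
`soloInformedHofWord u s = (binaryWord u).insertIdx s 1`, the index `soloInformedHofIdx u s` it spells,
its letters as a function on `Fin (m+2)` (`soloInformedHofLetters`), admissibility and weight; the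
identification of the inserted words at the block boundaries `Eᵢ = u₀ + ⋯ + u_{i−1}` and at the interior
slots `Eᵢ + a` with honest indices (`soloInformed_hofIdx_boundary`, `soloInformed_hofIdx_block`), and the
regrouping of a slot sum by blocks (`soloInformed_sum_slots_by_blocks`).  Pure list/`Finset` algebra.

References: M. Hoffman, Multiple harmonic series, Pacific J. Math. 152 (1992), Thm 5.1;
M. Kaneko, S. Yamamoto, arXiv:1605.03117 §4.
-/

open Literature.NumberTheory.Transcendental

namespace Summit.KontsevichZagierPeriods.KontsevichZagierPeriods.Theorems

variable {m : ℕ}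

/-! ## 1. The word with the letter `1` inserted at a slot -/

/-- `getD` of a list with one inserted entry. -/
theorem soloInformed_getD_insertIdx (L : List Bool) {s : ℕ} (hs : s ≤ L.length) (b d : Bool) (j : ℕ) :
    (L.insertIdx s b).getD j d =
      if j < s then L.getD j d else if j = s then b else L.getD (j - 1) d := by
  induction L generalizing s j with
  | nil =>
    simp only [List.length_nil, Nat.le_zero] at hs
    subst hs
    cases j <;> simp
  | cons a L ih =>
    cases s with
    | zero => cases j <;> simp
    | succ s =>
      cases j with
      | zero => simp
      | succ j =>
        rw [List.insertIdx_succ_cons, List.getD_cons_succ, ih (by simpa using hs)]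
        simp only [Nat.succ_lt_succ_iff, Nat.succ_inj, Nat.add_sub_cancel]
        split_ifs with h1 h2
        · rfl
        · rfl
        · obtain ⟨j', rfl⟩ : ∃ j', j = j' + 1 := ⟨j - 1, by omega⟩
          rw [Nat.add_sub_cancel, List.getD_cons_succ]

/-- The word of `u` with the letter `1` inserted at position `s`. -/
def soloInformedHofWord (u : List ℕ) (s : ℕ) : List Bool := (MZV.binaryWord u).insertIdx s true

/-- The index attached to the slot `s`: the index read off the inserted word. -/
def soloInformedHofIdx (u : List ℕ) (s : ℕ) : List ℕ := MZV.ofBinaryWord (soloInformedHofWord u s)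

/-- The letters of the piece at pendant slot `s`, as a function on `Fin (m+2)`. -/
def soloInformedHofLetters (u : List ℕ) (m : ℕ) (s : Fin (m + 2)) : Fin (m + 2) → Bool :=
  fun j => (soloInformedHofWord u s).getD j false

section word

variable {u : List ℕ} (hu : MZV.IsAdmissible u) (hw : MZV.weight u = m + 1)
include hu hw

/-- The word of `u` has length `m + 1`. -/
theorem soloInformed_length_binaryWord : (MZV.binaryWord u).length = m + 1 := by
  rw [hu.length_binaryWord, hw]

/-- **The letters of the piece**: `ε` below `s`, `1` at `s`, `ε` shifted above `s`. -/
theorem soloInformed_hofLetters_apply (s j : Fin (m + 2)) : soloInformedHofLetters u m s j =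
    if (j : ℕ) < s then (MZV.binaryWord u).getD j false else
      if (j : ℕ) = s then true else (MZV.binaryWord u).getD (j - 1) false := by
  unfold soloInformedHofLetters soloInformedHofWord
  rw [soloInformed_getD_insertIdx _ (by rw [soloInformed_length_binaryWord hu hw]; omega)]

/-- Auxiliary (Hoffman pieces): the inserted letter. -/
theorem soloInformed_hofLetters_self (s : Fin (m + 2)) : soloInformedHofLetters u m s s = true := by
  rw [soloInformed_hofLetters_apply hu hw]
  simp

/-- Auxiliary (Hoffman pieces): the letters of `ε` sit at the slots `succAbove s i`. -/
theorem soloInformed_hofLetters_succAbove (s : Fin (m + 2)) (i : Fin (m + 1)) :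
    soloInformedHofLetters u m s (Fin.succAbove s i) = soloInformedWordFn u m i := by
  rw [soloInformed_hofLetters_apply hu hw, soloInformedWordFn_apply]
  by_cases h : Fin.castSucc i < s
  · rw [Fin.succAbove_of_castSucc_lt _ _ h, if_pos (by simpa [Fin.lt_def] using h), Fin.val_castSucc]
  · rw [not_lt] at h
    have h' : (s : ℕ) ≤ i := by simpa [Fin.le_def] using h
    rw [Fin.succAbove_of_le_castSucc _ _ h, Fin.val_succ, if_neg (by omega), if_neg (by omega),
      Nat.add_sub_cancel]

/-- The first letter of `ε` is `0` (`u₀ ≥ 2`). -/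
theorem soloInformed_wordFn_zero : soloInformedWordFn u m 0 = false := by
  obtain ⟨a, u', rfl⟩ := List.exists_cons_of_ne_nil (soloInformed_ne_nil_of_weight hw)
  rw [soloInformedWordFn_apply, Fin.val_zero]
  exact MZV.getD_binaryWord_cons_zero (hu.2 (List.cons_ne_nil a u'))

/-- The inserted word has length `m + 2` (for `s ≤ m + 1`). -/
theorem soloInformed_length_hofWord {s : ℕ} (hs : s ≤ m + 1) : (soloInformedHofWord u s).length = m + 2 := by
  rw [soloInformedHofWord, List.length_insertIdx, soloInformed_length_binaryWord hu hw, if_pos hs]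

/-- The inserted word is nonempty. -/
theorem soloInformed_hofWord_ne_nil (s : Fin (m + 2)) : soloInformedHofWord u s ≠ [] := by
  rw [Ne, ← List.length_eq_zero_iff, soloInformed_length_hofWord hu hw (by omega)]
  omega

omit hu hw in
/-- `getD` of the inserted word at a `Fin` index is the letter function. -/
theorem soloInformed_hofWord_getD (s j : Fin (m + 2)) :
    (soloInformedHofWord u s).getD j false = soloInformedHofLetters u m s j := rfl

/-- The inserted word does not start with `1` (for `s ≠ 0`). -/
theorem soloInformed_hofWord_head {s : Fin (m + 2)} (hs : s ≠ 0) :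
    (soloInformedHofWord u s).head? ≠ some true := by
  have h0 : (soloInformedHofWord u s).getD 0 false = false := by
    rw [show (0 : ℕ) = ((0 : Fin (m + 2)) : ℕ) from rfl, soloInformed_hofWord_getD,
      ← Fin.succAbove_ne_zero_zero hs, soloInformed_hofLetters_succAbove hu hw, soloInformed_wordFn_zero hu hw]
  obtain ⟨b, L, hL⟩ := List.exists_cons_of_ne_nil (soloInformed_hofWord_ne_nil hu hw s)
  rw [hL] at h0 ⊢
  simp only [List.getD_cons_zero] at h0
  simp [h0]

/-- The inserted word ends with `1`. -/
theorem soloInformed_hofWord_getLast (s : Fin (m + 2)) :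
    (soloInformedHofWord u s).getLast? = some true := by
  have h : soloInformedHofLetters u m s (Fin.last (m + 1)) = true := by
    by_cases hs : s = Fin.last (m + 1)
    · rw [← hs, soloInformed_hofLetters_self hu hw]
    · rw [← Fin.succAbove_ne_last_last hs, soloInformed_hofLetters_succAbove hu hw,
        soloInformed_wordFn_last hu hw]
  have hlen := soloInformed_length_hofWord hu hw (show (s : ℕ) ≤ m + 1 by omega)
  rw [List.getLast?_eq_getElem?, hlen, show m + 2 - 1 = m + 1 by omega,
    List.getElem?_eq_getElem (by rw [hlen]; omega)]
  congr 1
  unfold soloInformedHofLetters at h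
  rwa [Fin.val_last, List.getD_eq_getElem _ _ (by rw [hlen]; omega)] at h

/-- **The attached index is admissible** (for `s ≠ 0`). -/
theorem soloInformed_hofIdx_admissible {s : Fin (m + 2)} (hs : s ≠ 0) :
    MZV.IsAdmissible (soloInformedHofIdx u s) :=
  MZV.isAdmissible_ofBinaryWord (soloInformed_hofWord_head hu hw hs)

/-- **The attached index has weight `m + 2`.** -/
theorem soloInformed_hofIdx_weight (s : Fin (m + 2)) : MZV.weight (soloInformedHofIdx u s) = m + 2 := by
  rw [soloInformedHofIdx, MZV.weight_ofBinaryWord (soloInformed_hofWord_ne_nil hu hw s)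
    (soloInformed_hofWord_getLast hu hw s), soloInformed_length_hofWord hu hw (by omega)]

/-- **The word of the attached index** is the inserted word. -/
theorem soloInformed_binaryWord_hofIdx (s : Fin (m + 2)) :
    MZV.binaryWord (soloInformedHofIdx u s) = soloInformedHofWord u s :=
  MZV.binaryWord_ofBinaryWord (soloInformed_hofWord_ne_nil hu hw s) (soloInformed_hofWord_getLast hu hw s)

/-- Its letters at `Fin` indices. -/
theorem soloInformed_hofIdx_getD (s l : Fin (m + 2)) :
    (MZV.binaryWord (soloInformedHofIdx u s)).getD l false = soloInformedHofLetters u m s l := by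
  rw [soloInformed_binaryWord_hofIdx hu hw]
  rfl

end word

/-! ## 2. Inserted words are words of indices -/

/-- Inserting past a prefix. -/
theorem soloInformed_insertIdx_length_add (l₁ l₂ : List Bool) (a : ℕ) (b : Bool) :
    (l₁ ++ l₂).insertIdx (l₁.length + a) b = l₁ ++ l₂.insertIdx a b := by
  induction l₁ with
  | nil => simp
  | cons x l ih =>
    rw [List.length_cons, show l.length + 1 + a = (l.length + a) + 1 by omega, List.cons_append,
      List.insertIdx_succ_cons, ih, List.cons_append]

/-- Inserting right after a prefix. -/
theorem soloInformed_insertIdx_length (l₁ l₂ : List Bool) (b : Bool) :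
    (l₁ ++ l₂).insertIdx l₁.length b = l₁ ++ b :: l₂ := by
  simpa using soloInformed_insertIdx_length_add l₁ l₂ 0 b

/-- Inserting right after a run. -/
theorem soloInformed_insertIdx_replicate_append (a : ℕ) (L : List Bool) (b c : Bool) :
    (List.replicate a c ++ L).insertIdx a b = List.replicate a c ++ b :: L := by
  induction a with
  | zero => simp
  | succ a ih => rw [List.replicate_succ, List.cons_append, List.insertIdx_succ_cons, ih, List.cons_append]

section

variable {u : List ℕ} {k : ℕ} (hpos : ∀ n ∈ u, 1 ≤ n) (hk : u.length = k + 1)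
include hpos hk

omit hk in
/-- The length of the word of a prefix is the prefix sum. -/
theorem soloInformed_length_binaryWord_take (i : ℕ) :
    (MZV.binaryWord (u.take i)).length = (u.take i).sum :=
  MZV.length_binaryWord fun n hn => hpos n (List.mem_of_mem_take hn)

omit hk in
/-- **Boundary slots.**  Inserting `1` at the block boundary `Eᵢ = u₀ + ⋯ + u_{i−1}` gives the word of
`(u₀, …, u_{i−1}, 1, uᵢ, …)`. -/
theorem soloInformed_hofWord_boundary (i : ℕ) :
    soloInformedHofWord u (u.take i).sum = MZV.binaryWord (u.take i ++ 1 :: u.drop i) := by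
  have hsplit : MZV.binaryWord u = MZV.binaryWord (u.take i) ++ MZV.binaryWord (u.drop i) := by
    rw [← MZV.binaryWord_append, List.take_append_drop]
  rw [← soloInformed_length_binaryWord_take hpos i, soloInformedHofWord, hsplit,
    soloInformed_insertIdx_length, MZV.binaryWord_append]
  simp [MZV.binaryWord]

/-- **Interior slots.**  Inserting `1` at `Eᵢ + a` with `a ≤ uᵢ − 1` gives the word of
`(u₀, …, u_{i−1}, a + 1, uᵢ − a, u_{i+1}, …)`. -/
theorem soloInformed_hofWord_block {i a : ℕ} (hi : i ≤ k) (ha : a ≤ u[i]'(by omega) - 1) :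
    soloInformedHofWord u ((u.take i).sum + a) =
      MZV.binaryWord (u.take i ++ (a + 1) :: (u[i]'(by omega) - a) :: u.drop (i + 1)) := by
  have hsplit : MZV.binaryWord u = MZV.binaryWord (u.take i) ++
      (List.replicate a false ++ (List.replicate (u[i]'(by omega) - 1 - a) false ++ [true] ++
        MZV.binaryWord (u.drop (i + 1)))) := by
    conv_lhs => rw [← List.take_append_drop i u, ← List.getElem_cons_drop (by omega : i < u.length)]
    rw [MZV.binaryWord_append]
    simp only [MZV.binaryWord, List.append_assoc, List.singleton_append]
    rw [← List.append_assoc (List.replicate a false), ← List.replicate_add,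
      show a + (u[i] - 1 - a) = u[i] - 1 by omega]
  rw [← soloInformed_length_binaryWord_take hpos i, soloInformedHofWord, hsplit,
    soloInformed_insertIdx_length_add, soloInformed_insertIdx_replicate_append, MZV.binaryWord_append]
  congr 1
  simp only [MZV.binaryWord, Nat.add_sub_cancel, List.append_assoc, List.cons_append,
    List.nil_append, show u[i] - a - 1 = u[i] - 1 - a by omega]

omit hk in
/-- The attached index at a boundary slot. -/
theorem soloInformed_hofIdx_boundary (i : ℕ) :
    soloInformedHofIdx u (u.take i).sum = u.take i ++ 1 :: u.drop i := by
  rw [soloInformedHofIdx, soloInformed_hofWord_boundary hpos, MZV.ofBinaryWord_binaryWord]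
  intro n hn
  simp only [List.mem_append, List.mem_cons] at hn
  rcases hn with h | rfl | h
  · exact hpos n (List.mem_of_mem_take h)
  · exact le_rfl
  · exact hpos n (List.mem_of_mem_drop h)

/-- The attached index at an interior slot. -/
theorem soloInformed_hofIdx_block {i a : ℕ} (hi : i ≤ k) (ha : a ≤ u[i]'(by omega) - 1) :
    soloInformedHofIdx u ((u.take i).sum + a) =
      u.take i ++ (a + 1) :: (u[i]'(by omega) - a) :: u.drop (i + 1) := by
  rw [soloInformedHofIdx, soloInformed_hofWord_block hpos hk hi ha, MZV.ofBinaryWord_binaryWord]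
  have h1 := hpos (u[i]'(by omega)) (List.getElem_mem _)
  intro n hn
  simp only [List.mem_append, List.mem_cons] at hn
  rcases hn with h | rfl | rfl | h
  · exact hpos n (List.mem_of_mem_take h)
  · omega
  · omega
  · exact hpos n (List.mem_of_mem_drop h)

/-! ## 3. Regrouping the slot sum by blocks -/

omit hpos in
/-- Consecutive boundaries differ by the block length. -/
theorem soloInformed_take_sum_succ {i : ℕ} (hi : i ≤ k) :
    (u.take (i + 1)).sum = (u.take i).sum + u[i]'(by omega) := by
  rw [List.sum_take_succ _ _ (by omega)]

omit hpos in
/-- The last boundary is the weight. -/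
theorem soloInformed_take_sum_last : (u.take (k + 1)).sum = u.sum := by
  rw [List.take_of_length_le (by omega)]

/-- **Regrouping by blocks.**  The sum over the slots `1 … E_K` is the sum over the blocks `i < K` of
the interior slots `Eᵢ + a` (`1 ≤ a ≤ uᵢ − 1`) and the boundary slot `E_{i+1}`. -/
theorem soloInformed_sum_slots_by_blocks {M : Type*} [AddCommMonoid M] (F : ℕ → M) {K : ℕ}
    (hK : K ≤ k + 1) :
    ∑ s ∈ Finset.Ico 1 ((u.take K).sum + 1), F s =
      ∑ i ∈ Finset.range K,
        (∑ a ∈ Finset.Ico 1 (u.getD i 0), F ((u.take i).sum + a) + F ((u.take (i + 1)).sum)) := by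
  induction K with
  | zero => simp
  | succ K ih =>
    have hKk : K ≤ k := by omega
    have hget : u.getD K 0 = u[K]'(by omega) := List.getD_eq_getElem _ _ (by omega)
    have h1 : 1 ≤ u[K]'(by omega) := hpos _ (List.getElem_mem _)
    rw [Finset.sum_range_succ, ← ih (by omega), soloInformed_take_sum_succ hk hKk, hget,
      ← Finset.sum_Ico_consecutive F (show 1 ≤ (u.take K).sum + 1 by omega)
        (show (u.take K).sum + 1 ≤ (u.take K).sum + u[K] + 1 by omega), add_assoc]
    congr 1
    rw [← Finset.sum_Ico_succ_top h1 (fun a => F ((u.take K).sum + a)), Finset.sum_Ico_eq_sum_range,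
      Finset.sum_Ico_eq_sum_range, show (u.take K).sum + (u[K] + 1) - ((u.take K).sum + 1) = u[K] by omega,
      Nat.add_sub_cancel]
    exact Finset.sum_congr rfl fun x _ => by rw [add_assoc]

end

end Summit.KontsevichZagierPeriods.KontsevichZagierPeriods.Theorems
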